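import Literature.Topology.FourManifolds.CorkDecompositionMiddleLevel
import HarnessLib

/-!
# The cork decomposition theorem: the handlebody step of the printed proofs

Topic `Literature/Topology/FourManifolds` (fact item `provefact-Literature.corkDecomposition`).
The cork decomposition theorem `Literature.Topology.FourManifolds.corkDecomposition` (`CorkTwist.lean`;
Curtis–Freedman–Hsiang–Stong 1996, Matveyev 1996) rests on Matveyev's part 1 with Fact 1,
`Literature.Topology.FourManifolds.Matveyev1996_partOne_and_fact` (`CorkDecomposition.lean` §4;
`corkDecomposition_of_partOne_and_fact`, `SeamAdaptedWitnesses.lean`), whose printed proofs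
begin with a sentence of 5-dimensional handle theory:

> Matveyev (arXiv:dg-ga/9505001, Proof of Theorem, first two sentences): "*First, observe that
> `U` has a handlebody with no 1- and 4-handles. Let `N` be the middle level of `U` between 2-
> and 3-handles.*"  Kirby (Turkish J. Math. 20 (1996), §2): "*We begin with a Morse function
> `f : (M, M₀, M₁) → (I, 0, 1)` and its associated handlebody structure [...]. We can cancel all
> 0-handles and 5-handles [...]. We can cancel all 1-handles and 4-handles [...]. We can assume
> that `M_{1/2} = f⁻¹(1/2)` has all the 2-handles below and all the 3-handles above.*"

and from there on (Kirby §3: the contractible sub-h-cobordism `A ⊃` all handles, whence the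
Theorem; §4: Addenda (B) `A ≅ B⁵` and (C) `A₀ × I ≅ B⁵ ≅ A₁ × I`, read on the boundary;
Matveyev pp. 1–3: `V₀ ⊂ V₁ ⊂ V₂ ⊂ V₃`, surgery, and "Fact 1" by Kirby calculus) take place in
and around the middle level of such a handlebody: the middle level (B)
`Literature.Topology.FourManifolds.exists_dualSpheres_middleLevel_of_two_three` and the
four-dimensional construction in it (H4)
`Literature.Topology.FourManifolds.Matveyev1996_partOne_and_fact_of_dualSpheres`, the two
named facts of `CorkDecompositionMiddleLevel.lean`.

* `Literature.Topology.FourManifolds.matveyev1996_partOne_and_fact_of_two_three` — **proved**: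
  the handle-trading fact (K1) `Literature.Topology.FourManifolds.exists_isMorseFunction_two_three_of_isHCobordism`
  (`HCobordismHandles.lean`; Milnor 1965 §8, Freedman–Quinn 1990 proof of Thm. 7.1D, shared
  with the DAG of Freedman's theorem `HCobordismFreedman.lean`: a Morse function on the
  h-cobordism all of whose critical points have index `2` and value `< 1/2` or index `3` and
  value `> 1/2`) followed by (B) and (H4) gives `Matveyev1996_partOne_and_fact`.

(K1) is meanwhile a theorem of the tree (`exists_isMorseFunction_two_three_of_isHCobordism_holds`,
`HCobordismHandlesProofs.lean`), so `Matveyev1996_partOne_and_fact ⟸ (B) ∧ (H4)` outright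
(`matveyev1996_partOne_and_fact_of_middleLevel_leaves`, `CorkDecompositionProofs.lean`).

**History: the handlebody form (merged 2026-08-15, D-0026 review).**  This file originally
introduced an intermediate *named fact* `Matveyev1996_partOne_and_fact_of_two_three`, "the
handlebody form": the conclusion of `Matveyev1996_partOne_and_fact` for an h-cobordism
*equipped with* a two-three Morse function, i.e. that fact with the output of (K1) as an extra
hypothesis — so that `Matveyev1996_partOne_and_fact ⟸ (K1) ∧ handlebody form`
(the theorem below, in its first version) and conversely the handlebody form `⟸
Matveyev1996_partOne_and_fact` trivially.  It is not a distinct printed result but the printed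
theorem entered one sentence into its proof; its own prove-seat sized it XL and the tree split
it further into (B) ∧ (H4).  Once (K1) was discharged the handlebody form was unconditionally
equivalent to `Matveyev1996_partOne_and_fact` (the former
`matveyev1996_partOne_and_fact_iff_two_three_handlebody`), i.e. one proof obligation counted
twice, and the D-0026 review of bad splits merged it back into its parent: the `def` and the
glue theorems mentioning it (`two_three_of_matveyev1996_partOne_and_fact`,
`matveyev1996_partOne_and_fact_iff_two_three`, and those of `CorkDecompositionTwoThree.lean`,
`CorkDecompositionMilnor.lean`, `CorkDecompositionMiddleLevel.lean`,
`CorkDecompositionMatveyevForm.lean`, `CorkDecompositionProofs.lean`) were withdrawn or re-proved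
from (B) ∧ (H4) directly, and what the handlebody form asserted survives as the proved relative
theorem `Matveyev1996_partOne_and_fact_of_dualSpheres.apply_two_three`
(`CorkDecompositionMiddleLevel.lean`).  The debt below `corkDecomposition` is exactly (B) and (H4).

## References

* R. Matveyev, *A decomposition of smooth simply-connected h-cobordant 4-manifolds*,
  J. Differential Geom. 44 (1996) 571–582; arXiv:dg-ga/9505001, Theorem 1, Proof of Theorem
  (pp. 1–2) and Fact 1 (p. 3). [Matveyev1996]
* R. Kirby, *Akbulut's corks and h-cobordisms of smooth, simply connected 4-manifolds*, Turkish
  J. Math. 20 (1996) 85–93; arXiv:math/9712231, Theorem, Addenda (B)–(D), §§2–5. [KirbyCorks1996]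
* C. L. Curtis, M. H. Freedman, W.-C. Hsiang, R. Stong, *A decomposition theorem for h-cobordant
  smooth simply-connected compact 4-manifolds*, Invent. Math. 123 (1996) 343–348, Theorem.
  [CurtisFreedmanHsiangStong1996]
* J. Milnor, *Lectures on the h-cobordism theorem* (1965), Def. 3.1, Thm. 4.8, §8.
  [MilnorHCobordism1965]
* M. H. Freedman, F. Quinn, *Topology of 4-manifolds*, Princeton (1990), proof of Thm. 7.1D
  (p. 85). [FreedmanQuinnPMS1990]
-/

noncomputable section

namespace Literature.Topology.FourManifolds

universe u

/-- **`Matveyev1996_partOne_and_fact` from handle trading, (B) and (H4)** — the structure of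
the printed proofs: their first sentence, the handle-trading fact (K1)
`Literature.Topology.FourManifolds.exists_isMorseFunction_two_three_of_isHCobordism` (a simply connected smooth 5-dimensional
h-cobordism between closed 4-manifolds carries a Morse function with only index-`2` critical
points below `1/2` and index-`3` critical points above; Milnor 1965 §8, Kirby 1996 §2, Matveyev
1996 Proof of Theorem, first sentence), then the middle level of that handlebody (B)
`Literature.Topology.FourManifolds.exists_dualSpheres_middleLevel_of_two_three` and the
four-dimensional construction in it (H4)
`Literature.Topology.FourManifolds.Matveyev1996_partOne_and_fact_of_dualSpheres`
(`Matveyev1996_partOne_and_fact_of_dualSpheres.apply_two_three`).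
[cite: Matveyev1996, Proof of Theorem, first two sentences (arXiv p. 1), pp. 1–3 and Fact 1]
[cite: KirbyCorks1996, §2 and §§3–4] -/
theorem matveyev1996_partOne_and_fact_of_two_three
    (h₁ : exists_isMorseFunction_two_three_of_isHCobordism.{u})
    (hB : exists_dualSpheres_middleLevel_of_two_three.{u})
    (h4 : Matveyev1996_partOne_and_fact_of_dualSpheres.{u}) :
    Matveyev1996_partOne_and_fact.{u} := by
  intro X₁ X₂ _ _ _ _ _ _ _ _ _ _ _ _ _ _ hcob
  obtain ⟨c, hc⟩ := hcob
  obtain ⟨f, hf, hind, -⟩ := h₁ X₁ X₂ c hc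
  exact h4.apply_two_three hB c f hc hf hind

end Literature.Topology.FourManifolds

end
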